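import Summits.QuantumFields.YangMills.Theorems.BalabanUVNodesN20InhomogeneousBlockCaricature

/-!
# BalabanUVNodes ∕ N20·N19′·N21 — THE HELLINGER DICTIONARY OF THE CARICATURE WITH PER-BLOCK RATES (FILE R): CRIT-1's statistic is ADDITIVE over non-exchangeable blocks —
# with `Λ_K := Σ_{i<n_K} Λ₁(p_{K,i}, q_{K,i})`, `Λ₁(p,q) = (q−p)²·(1∕(p+q) + 1∕(2−p−q))`, the affinity defect obeys `1 − e^{−Λ_K∕4} ≤ 1 − bc_K ≤ Λ_K∕2`, so on the caricature
# `Σ_K Λ_K < ∞` is NECESSARY and `Σ_K √Λ_K < ∞` SUFFICIENT for K3 stub 2's dials (FILE Q's ℓ¹ letter `Σ_K Σ_i |q_{K,i} − p_{K,i}|` sits in between: sufficient always, sharp in the rare window)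

Cell `pub-ymgap` (HUMAN RULING D-0062 Track A; work-bound push D-0149, director-ym №197), width seat `pub-ymgap-dag-n20-w1` (gen 7) on node N20 = NE7b; key item of this
seat's payload K3⁷ `SpineGivenEndpointR13SepCoPH` = stmt-QuantumFields-20544 (ASIDE; lineage of K3⁸ `SpineGivenEndpointR13SepCoPHV` = stmt-QuantumFields-27366, skeleton v6
b4e55110ab73e679 UNTOUCHED; `--kind proof --supports 20544 --as helper`, MIS-KEY rule R463 (4)(a)); COUNT-NEUTRAL.  Bus: CLAIM-22 ∕ INTENT-27.
THEOREMS ONLY (0 def ∕ instance ∕ notation ∕ sorry); imports this seat's FILE Q `…N20InhomogeneousBlockCaricature` ONLY (through it FILES A∕D and dag-n20-w4 p609004, BY NAME).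

WHY.  FILE D §4 showed, for EXCHANGEABLE blocks, that the Hellinger road's two letters and CRIT-1's statistic `Λ_K = n_K·Λ₁(p_K, q_K)` are one currency: `Σ(1 − bc_K) < ∞ ⟺ Σ Λ_K < ∞`
(necessity) and `Σ H_K < ∞ ⟺ Σ √Λ_K < ∞` (sufficiency).  FILE Q removed exchangeability from the caricature (per-block rates `p_{K,i}, q_{K,i}`; affinity still multiplicative,
`bc = ∏_i u_i`, `u_i = √(p_i q_i) + √((1−p_i)(1−q_i))`).  This file is the dictionary at that generality: the statistic becomes the SUM of the per-block statistics,
`Λ_U := Σ_{i∈U} Λ₁(p_i, q_i)`, and the SAME two-sided bracket holds (§1 ★ `defect_prod_brackets`: `1 − e^{−Λ_U∕4} ≤ 1 − ∏_U u_i ≤ Λ_U∕2`, from FILE A's one-block brackets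
`Λ₁∕4 ≤ 1 − u ≤ Λ₁∕2`, `1 − ∏ u ≤ Σ(1 − u)` and `∏ u ≤ e^{−Σ(1−u)}` — the latter inlined; it is dag-n19's `N19AffinityCurrency.prod_le_exp_neg_sum_one_sub`).  §2 abstracts FILE D §4's two summability arguments to ANY sequences in that bracket
(`summable_iff_of_expBracket`, `summable_sqrt_iff_of_expBracket`).  §3, along `K` on the carriers `(range n_K).powerset`: ★★ `summable_blockStat_of_exists_hybridNE7` — SOME dials give node U5's
`HybridNE7` ⇒ `Σ_K Λ_K < ∞` (dag-n20-w4's TV radius ≥ the affinity defect on FILE A's Hahn-type set); ★★ `exists_hybridNE7_inhomCaricature_of_summable_sqrt_blockStat` — `Σ_K √Λ_K < ∞` ⇒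
dials (Le Cam `TV ≤ √(1 − bc²) ≤ √Λ` on every class set, FILE Q's exact ℓ¹ criterion); `summable_defect_iff_summable_blockStat` ∕ `summable_sqrt_defect_iff_…` (the two letters ARE the
two statistics); `blockStat_const` (exchangeable case = FILE D's `n_K·Λ₁`).
LOCATED READING (caricature currency, nothing at the record; for CRIT-1 ∕ idea-3 ∕ the plan's window key): with per-block rates CRIT-1's «λ_K» is `Σ_{blocks} (q_{K,i} − p_{K,i})²∕(p_{K,i} + q_{K,i})`
(up to the symmetric factor): its summability over `K` is NECESSARY for stub 2's dials on the caricature, the summability of its square roots SUFFICIENT; the gap between the two is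
Le Cam's and is bridged, in the rare window only, by FILE Q's ℓ¹ letter — so a per-block record reading (two one-run large-field probabilities per coarse block of the window) would
decide the caricature verdict by ONE of three lines (`Σ Λ`, `Σ Σ|q − p|`, `Σ √Λ`).

HONEST FRAMING.  [folklore] finite-sum probability ∕ real analysis on a CARICATURE (independent, NON-identically distributed blocks; product Bernoulli class weights); nothing read at
the record (`classSet₁₃ ∕ weightA₁₃ ∕ weightB₁₃` untouched; (LS)∕(XG′)∕(SAT′) at the record UNDECIDED); proves NO estimate of Bałaban's; refutes NO registered stub; nothing of Bałaban's
asserted or instantiated.  NE7 ∕ NE7b ∕ NE7c NOT PRINTED for `d = 4`, NOT proved; N19 ∕ N20 ∕ N21 NOT discharged; K3⁸ ∕ K3⁷ OPEN; counts unmoved (typed 28∕28 · discharged 5∕27); no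
count claim.  One finite `𝕋⁴_{L^K}` programme at fixed `ε = L^{−K}`, Bałaban AS PRINTED; the YM mass gap (Clay) is NOT proved by any of this — R4 closes the conditional finite-𝕋⁴
rung `BalabanLadder.UV` only; NOT ℝ⁴, NOT OS.  No decl carries a cite tag.
-/

noncomputable section

open Finset Filter Topology
open Literature.MathematicalPhysics.QuantumFieldTheory.Balaban1983to89
open Literature.MathematicalPhysics.QuantumFieldTheory.Balaban1983to89.T4MatchingAssembly (HybridNE7)
open Summit.QuantumFields.YangMills.BalabanUVNodes.N20BlockCaricatureAffinity
open Summit.QuantumFields.YangMills.BalabanUVNodes.N20HybridClassLawCharacterisation (exists_tvRadius_of_hybridNE7)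
open Summit.QuantumFields.YangMills.BalabanUVNodes.N20InhomogeneousBlockCaricature

namespace Summit.QuantumFields.YangMills.BalabanUVNodes.N20InhomogeneousBlockCaricatureHellinger

/-! ## §1 One step: the affinity defect of the product against the summed per-block statistic -/

section OneStep

variable {ι : Type*} [DecidableEq ι]

/-- `1 − ∏_U u ≤ Σ_U (1 − u)` for `u_i ∈ [0, 1]` (union bound ∕ Weierstrass, by induction on the block set). [folklore] -/
theorem one_sub_prod_le_sum_one_sub (U : Finset ι) {u : ι → ℝ} (hu : ∀ i ∈ U, 0 ≤ u i ∧ u i ≤ 1) :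
    1 - ∏ i ∈ U, u i ≤ ∑ i ∈ U, (1 - u i) := by
  induction U using Finset.induction_on with
  | empty => simp
  | insert a U ha IH =>
    have huU : ∀ i ∈ U, 0 ≤ u i ∧ u i ≤ 1 := fun i hi => hu i (Finset.mem_insert_of_mem hi)
    have hua := hu a (Finset.mem_insert_self a U)
    rw [Finset.prod_insert ha, Finset.sum_insert ha]
    have hP1 : ∏ i ∈ U, u i ≤ 1 := Finset.prod_le_one (fun i hi => (huU i hi).1) fun i hi => (huU i hi).2
    nlinarith [IH huU, Finset.prod_nonneg fun i hi => (huU i hi).1, mul_nonneg (sub_nonneg.2 hua.2) (sub_nonneg.2 hP1)]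

/-- ★ **THE DEFECT BRACKETS, PER-BLOCK RATES** [folklore]: with `u_i = √(p_i q_i) + √((1−p_i)(1−q_i))` and `Λ_U = Σ_{i∈U} Λ₁(p_i, q_i)`,
`1 − e^{−Λ_U∕4} ≤ 1 − ∏_{i∈U} u_i ≤ Λ_U∕2` — FILE D §4's brackets with `n·Λ₁` replaced by the SUM of the per-block statistics (FILE A's one-block brackets `Λ₁∕4 ≤ 1 − u ≤ Λ₁∕2`). -/
theorem defect_prod_brackets (U : Finset ι) {p q : ι → ℝ} (hp : ∀ i ∈ U, 0 ≤ p i ∧ p i ≤ 1) (hq : ∀ i ∈ U, 0 ≤ q i ∧ q i ≤ 1) :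
    1 - Real.exp (-(∑ i ∈ U, ((q i - p i) ^ 2 / (p i + q i) + (q i - p i) ^ 2 / (2 - p i - q i))) / 4) ≤
        1 - ∏ i ∈ U, (Real.sqrt (p i * q i) + Real.sqrt ((1 - p i) * (1 - q i))) ∧
      1 - ∏ i ∈ U, (Real.sqrt (p i * q i) + Real.sqrt ((1 - p i) * (1 - q i))) ≤
        (∑ i ∈ U, ((q i - p i) ^ 2 / (p i + q i) + (q i - p i) ^ 2 / (2 - p i - q i))) / 2 := by
  have hu : ∀ i ∈ U, 0 ≤ Real.sqrt (p i * q i) + Real.sqrt ((1 - p i) * (1 - q i)) ∧ Real.sqrt (p i * q i) + Real.sqrt ((1 - p i) * (1 - q i)) ≤ 1 :=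
    fun i hi => ⟨affinity₁_nonneg _ _, by
      linarith [stat_div_four_le_one_sub_affinity₁ (hp i hi).1 (hq i hi).1 (hp i hi).2 (hq i hi).2, stat₁_nonneg (hp i hi).1 (hq i hi).1 (hp i hi).2 (hq i hi).2]⟩
  have hlo : (∑ i ∈ U, ((q i - p i) ^ 2 / (p i + q i) + (q i - p i) ^ 2 / (2 - p i - q i))) / 4 ≤
      ∑ i ∈ U, (1 - (Real.sqrt (p i * q i) + Real.sqrt ((1 - p i) * (1 - q i)))) := by
    rw [Finset.sum_div]
    exact Finset.sum_le_sum fun i hi => stat_div_four_le_one_sub_affinity₁ (hp i hi).1 (hq i hi).1 (hp i hi).2 (hq i hi).2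
  have hhi : ∑ i ∈ U, (1 - (Real.sqrt (p i * q i) + Real.sqrt ((1 - p i) * (1 - q i)))) ≤
      (∑ i ∈ U, ((q i - p i) ^ 2 / (p i + q i) + (q i - p i) ^ 2 / (2 - p i - q i))) / 2 := by
    rw [Finset.sum_div]
    exact Finset.sum_le_sum fun i hi => one_sub_affinity₁_le_stat_div_two (hp i hi).1 (hq i hi).1 (hp i hi).2 (hq i hi).2
  refine ⟨?_, (one_sub_prod_le_sum_one_sub U hu).trans hhi⟩
  -- `∏ u ≤ e^{−Σ(1−u)}` blockwise from `u ≤ e^{u−1}` (the tree's `N19AffinityCurrency.prod_le_exp_neg_sum_one_sub`, a three-line fact inlined rather than importing a measure-theory module)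
  have h1 : ∏ i ∈ U, (Real.sqrt (p i * q i) + Real.sqrt ((1 - p i) * (1 - q i))) ≤
      Real.exp (-∑ i ∈ U, (1 - (Real.sqrt (p i * q i) + Real.sqrt ((1 - p i) * (1 - q i))))) := by
    rw [← Finset.sum_neg_distrib, Real.exp_sum]
    exact Finset.prod_le_prod (fun i hi => (hu i hi).1) fun i _ => by linarith [Real.add_one_le_exp (-(1 - (Real.sqrt (p i * q i) + Real.sqrt ((1 - p i) * (1 - q i)))))]
  have h2 : Real.exp (-∑ i ∈ U, (1 - (Real.sqrt (p i * q i) + Real.sqrt ((1 - p i) * (1 - q i))))) ≤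
      Real.exp (-(∑ i ∈ U, ((q i - p i) ^ 2 / (p i + q i) + (q i - p i) ^ 2 / (2 - p i - q i))) / 4) := Real.exp_le_exp.2 (by linarith)
  linarith

/-- **LE CAM ON THE PRODUCT** [folklore]: the ℓ¹ distance of the two configuration laws is at most `2·√Λ_U` (`TV ≤ √(1 − bc²) ≤ √(2(1 − bc)) ≤ √Λ_U` on every class set, read on the
Hahn set through FILE Q's `sum_abs_sub_le_two_mul_of_classSetGap_le`). -/
theorem l1_prodConfig_le_two_mul_sqrt_blockStat (U : Finset ι) {p q : ι → ℝ} (hp : ∀ i ∈ U, 0 ≤ p i ∧ p i ≤ 1) (hq : ∀ i ∈ U, 0 ≤ q i ∧ q i ≤ 1) :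
    ∑ S ∈ U.powerset, |(∏ i ∈ S, q i) * ∏ i ∈ U \ S, (1 - q i) - (∏ i ∈ S, p i) * ∏ i ∈ U \ S, (1 - p i)| ≤
      2 * Real.sqrt (∑ i ∈ U, ((q i - p i) ^ 2 / (p i + q i) + (q i - p i) ^ 2 / (2 - p i - q i))) := by
  refine sum_abs_sub_le_two_mul_of_classSetGap_le _ (by rw [sum_prodConfig_eq_one, sum_prodConfig_eq_one]) fun 𝒮 h𝒮 => ?_
  have hLC := abs_sub_le_sqrt_one_sub_affinity_sq U.powerset (a := fun S => (∏ i ∈ S, p i) * ∏ i ∈ U \ S, (1 - p i))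
    (b := fun S => (∏ i ∈ S, q i) * ∏ i ∈ U \ S, (1 - q i)) (fun S hS => prodConfig_nonneg hp (Finset.mem_powerset.1 hS))
    (fun S hS => prodConfig_nonneg hq (Finset.mem_powerset.1 hS)) (sum_prodConfig_eq_one U p) (sum_prodConfig_eq_one U q) h𝒮
  rw [affinity_prodConfig_eq_prod U hp hq] at hLC
  refine hLC.trans (Real.sqrt_le_sqrt ?_)
  set B := ∏ i ∈ U, (Real.sqrt (p i * q i) + Real.sqrt ((1 - p i) * (1 - q i)))
  have hB0 : 0 ≤ B := Finset.prod_nonneg fun i _ => affinity₁_nonneg _ _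
  have hB := (defect_prod_brackets U hp hq).2
  have hΛ0 : 0 ≤ ∑ i ∈ U, ((q i - p i) ^ 2 / (p i + q i) + (q i - p i) ^ 2 / (2 - p i - q i)) :=
    Finset.sum_nonneg fun i hi => stat₁_nonneg (hp i hi).1 (hq i hi).1 (hp i hi).2 (hq i hi).2
  nlinarith

end OneStep

/-! ## §2 Two summability transfers through the bracket `1 − e^{−Λ∕4} ≤ Δ ≤ Λ∕2` (FILE D §4's arguments, abstracted) -/

section Bracket

variable {Δ Λ : ℕ → ℝ}

/-- `Summable Δ ⟺ Summable Λ` for non-negative `Λ` and `Δ` in the bracket `1 − e^{−Λ_K∕4} ≤ Δ_K ≤ Λ_K∕2` (summable `Δ` forces `Λ_K ≤ 4` eventually, where `Λ∕8 ≤ 1 − e^{−Λ∕4}`). [folklore] -/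
theorem summable_iff_of_expBracket (hΛ0 : ∀ K, 0 ≤ Λ K) (hlo : ∀ K, 1 - Real.exp (-Λ K / 4) ≤ Δ K) (hhi : ∀ K, Δ K ≤ Λ K / 2) : Summable Δ ↔ Summable Λ := by
  have hg0 : ∀ K, 0 ≤ 1 - Real.exp (-Λ K / 4) := fun K => by
    have : Real.exp (-Λ K / 4) ≤ Real.exp 0 := Real.exp_le_exp.2 (by linarith [hΛ0 K])
    rw [Real.exp_zero] at this; linarith
  have hΔ0 : ∀ K, 0 ≤ Δ K := fun K => (hg0 K).trans (hlo K)
  have hlin : ∀ K, Λ K ≤ 4 → Λ K / 8 ≤ 1 - Real.exp (-Λ K / 4) := fun K _ => by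
    have h1 : Real.exp (-(Λ K / 4)) * (1 + Λ K / 4) ≤ 1 := by
      calc Real.exp (-(Λ K / 4)) * (1 + Λ K / 4) ≤ Real.exp (-(Λ K / 4)) * Real.exp (Λ K / 4) :=
            mul_le_mul_of_nonneg_left (by linarith [Real.add_one_le_exp (Λ K / 4)]) (Real.exp_pos _).le
        _ = 1 := by rw [← Real.exp_add, neg_add_cancel, Real.exp_zero]
    have e : Real.exp (-(Λ K / 4)) = Real.exp (-Λ K / 4) := by congr 1; ring
    rw [e] at h1
    nlinarith [Real.exp_pos (-Λ K / 4), hΛ0 K]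
  constructor
  · intro hΔ
    have hg : Summable fun K => 1 - Real.exp (-Λ K / 4) := Summable.of_nonneg_of_le hg0 hlo hΔ
    have hev : ∀ᶠ K in atTop, Λ K ≤ 4 := by
      have hc : (0 : ℝ) < 1 - Real.exp (-1) := by
        have : Real.exp (-1) < Real.exp 0 := Real.exp_lt_exp.2 (by norm_num)
        rw [Real.exp_zero] at this; linarith
      filter_upwards [hg.tendsto_atTop_zero.eventually (gt_mem_nhds hc)] with K hK
      by_contra h4
      have : Real.exp (-Λ K / 4) ≤ Real.exp (-1) := Real.exp_le_exp.2 (by linarith [not_le.1 h4])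
      linarith
    refine Summable.of_norm_bounded_eventually_nat (hg.mul_left 8) ?_
    filter_upwards [hev] with K hK
    rw [Real.norm_eq_abs, abs_of_nonneg (hΛ0 K)]
    linarith [hlin K hK]
  · intro hΛs
    exact Summable.of_nonneg_of_le hΔ0 hhi (hΛs.div_const 2)

/-- `Summable √Δ ⟺ Summable √Λ` in the same bracket (`√Λ ≤ √8·√Δ` eventually; `√Δ ≤ √Λ` always). [folklore] -/
theorem summable_sqrt_iff_of_expBracket (hΛ0 : ∀ K, 0 ≤ Λ K) (hlo : ∀ K, 1 - Real.exp (-Λ K / 4) ≤ Δ K) (hhi : ∀ K, Δ K ≤ Λ K / 2) :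
    (Summable fun K => Real.sqrt (Δ K)) ↔ Summable fun K => Real.sqrt (Λ K) := by
  have hlin : ∀ K, Λ K ≤ 4 → Λ K / 8 ≤ 1 - Real.exp (-Λ K / 4) := fun K _ => by
    have h1 : Real.exp (-(Λ K / 4)) * (1 + Λ K / 4) ≤ 1 := by
      calc Real.exp (-(Λ K / 4)) * (1 + Λ K / 4) ≤ Real.exp (-(Λ K / 4)) * Real.exp (Λ K / 4) :=
            mul_le_mul_of_nonneg_left (by linarith [Real.add_one_le_exp (Λ K / 4)]) (Real.exp_pos _).le
        _ = 1 := by rw [← Real.exp_add, neg_add_cancel, Real.exp_zero]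
    have e : Real.exp (-(Λ K / 4)) = Real.exp (-Λ K / 4) := by congr 1; ring
    rw [e] at h1
    nlinarith [Real.exp_pos (-Λ K / 4), hΛ0 K]
  constructor
  · intro hΔ
    have hev : ∀ᶠ K in atTop, Λ K ≤ 4 := by
      have hc : (0 : ℝ) < Real.sqrt (1 - Real.exp (-1)) := Real.sqrt_pos.2 (by
        have : Real.exp (-1) < Real.exp 0 := Real.exp_lt_exp.2 (by norm_num)
        rw [Real.exp_zero] at this; linarith)
      filter_upwards [hΔ.tendsto_atTop_zero.eventually (gt_mem_nhds hc)] with K hK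
      by_contra h4
      have h5 : Real.exp (-Λ K / 4) ≤ Real.exp (-1) := Real.exp_le_exp.2 (by linarith [not_le.1 h4])
      have h6 : 1 - Real.exp (-1) ≤ Δ K := by linarith [hlo K]
      exact absurd hK (not_lt.2 (Real.sqrt_le_sqrt h6))
    refine Summable.of_norm_bounded_eventually_nat (hΔ.mul_left (Real.sqrt 8)) ?_
    filter_upwards [hev] with K hK
    rw [Real.norm_eq_abs, abs_of_nonneg (Real.sqrt_nonneg _), ← Real.sqrt_mul (by norm_num : (0 : ℝ) ≤ 8)]
    exact Real.sqrt_le_sqrt (by linarith [hlin K hK, hlo K])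
  · intro hΛs
    refine Summable.of_nonneg_of_le (fun K => Real.sqrt_nonneg _) (fun K => Real.sqrt_le_sqrt ?_) hΛs
    linarith [hhi K, hΛ0 K]

end Bracket

/-! ## §3 Along `K`: necessity of `Σ_K Λ_K`, sufficiency of `Σ_K √Λ_K`, and the two letters as statistics -/

section AlongK

variable (n : ℕ → ℕ) (p q : ℕ → ℕ → ℝ)

/-- `Σ_K (1 − bc_K) < ∞ ⟺ Σ_K Λ_K < ∞` with `bc_K = ∏_{i<n_K} u_{K,i}`, `Λ_K = Σ_{i<n_K} Λ₁(p_{K,i}, q_{K,i})`: the Hellinger road's NECESSITY letter is the summed statistic. [folklore] -/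
theorem summable_defect_iff_summable_blockStat (hp : ∀ K, ∀ i ∈ Finset.range (n K), 0 ≤ p K i ∧ p K i ≤ 1) (hq : ∀ K, ∀ i ∈ Finset.range (n K), 0 ≤ q K i ∧ q K i ≤ 1) :
    (Summable fun K => 1 - ∏ i ∈ Finset.range (n K), (Real.sqrt (p K i * q K i) + Real.sqrt ((1 - p K i) * (1 - q K i)))) ↔
      Summable fun K => ∑ i ∈ Finset.range (n K), ((q K i - p K i) ^ 2 / (p K i + q K i) + (q K i - p K i) ^ 2 / (2 - p K i - q K i)) :=
  summable_iff_of_expBracket (fun K => Finset.sum_nonneg fun i hi => stat₁_nonneg (hp K i hi).1 (hq K i hi).1 (hp K i hi).2 (hq K i hi).2)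
    (fun K => (defect_prod_brackets (Finset.range (n K)) (hp K) (hq K)).1) fun K => (defect_prod_brackets (Finset.range (n K)) (hp K) (hq K)).2

/-- `Σ_K √(1 − bc_K) < ∞ ⟺ Σ_K √Λ_K < ∞`: the Hellinger road's binding letter (V) `Σ H_K < ∞` is the summed statistic's square-root letter. [folklore] -/
theorem summable_sqrt_defect_iff_summable_sqrt_blockStat (hp : ∀ K, ∀ i ∈ Finset.range (n K), 0 ≤ p K i ∧ p K i ≤ 1)
    (hq : ∀ K, ∀ i ∈ Finset.range (n K), 0 ≤ q K i ∧ q K i ≤ 1) :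
    (Summable fun K => Real.sqrt (1 - ∏ i ∈ Finset.range (n K), (Real.sqrt (p K i * q K i) + Real.sqrt ((1 - p K i) * (1 - q K i))))) ↔
      Summable fun K => Real.sqrt (∑ i ∈ Finset.range (n K), ((q K i - p K i) ^ 2 / (p K i + q K i) + (q K i - p K i) ^ 2 / (2 - p K i - q K i))) :=
  summable_sqrt_iff_of_expBracket (fun K => Finset.sum_nonneg fun i hi => stat₁_nonneg (hp K i hi).1 (hq K i hi).1 (hp K i hi).2 (hq K i hi).2)
    (fun K => (defect_prod_brackets (Finset.range (n K)) (hp K) (hq K)).1) fun K => (defect_prod_brackets (Finset.range (n K)) (hp K) (hq K)).2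

/-- ★★ **NECESSITY OF THE SUMMED STATISTIC** [folklore ∕ bookkeeping]: if SOME dials give node U5's `HybridNE7` on the caricature with per-block rates, then `Σ_K Λ_K < ∞` — dag-n20-w4's
summable class-law TV radius dominates the affinity defect on FILE A's set `{w_p < w_q}` (`exists_subset_one_sub_affinity_le`), and the defect's summability is the statistic's. -/
theorem summable_blockStat_of_exists_hybridNE7 (hp : ∀ K, ∀ i ∈ Finset.range (n K), 0 ≤ p K i ∧ p K i ≤ 1)
    (hq : ∀ K, ∀ i ∈ Finset.range (n K), 0 ≤ q K i ∧ q K i ≤ 1) {l₀ : ℝ} (hl₀ : 0 ≤ l₀) {vol : ℝ}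
    (h : ∃ (Bad : ℕ → ℝ → Finset (Finset ℕ)) (W : ℕ → ℝ) (shA shB : ℕ → ℝ → Finset ℕ → ℝ) (Wsh δ : ℕ → ℝ),
      HybridNE7 l₀ vol (fun K => (Finset.range (n K)).powerset) (fun K _ S => (∏ i ∈ S, p K i) * ∏ i ∈ Finset.range (n K) \ S, (1 - p K i))
        (fun K _ S => (∏ i ∈ S, q K i) * ∏ i ∈ Finset.range (n K) \ S, (1 - q K i)) Bad W shA shB Wsh δ) :
    Summable fun K => ∑ i ∈ Finset.range (n K), ((q K i - p K i) ^ 2 / (p K i + q K i) + (q K i - p K i) ^ 2 / (2 - p K i - q K i)) := by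
  classical
  obtain ⟨Bad, W, shA, shB, Wsh, δ, hH⟩ := h
  have hZA : ∀ (K : ℕ) (t : ℝ), |t| ≤ l₀ → 0 < ∑ S ∈ (Finset.range (n K)).powerset, (∏ i ∈ S, p K i) * ∏ i ∈ Finset.range (n K) \ S, (1 - p K i) :=
    fun K t _ => by rw [sum_prodConfig_eq_one]; exact one_pos
  have hZB : ∀ (K : ℕ) (t : ℝ), |t| ≤ l₀ → 0 < ∑ S ∈ (Finset.range (n K)).powerset, (∏ i ∈ S, q K i) * ∏ i ∈ Finset.range (n K) \ S, (1 - q K i) :=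
    fun K t _ => by rw [sum_prodConfig_eq_one]; exact one_pos
  obtain ⟨ρ, -, hρs, hρ⟩ := exists_tvRadius_of_hybridNE7 hH hZA hZB
  refine (summable_defect_iff_summable_blockStat n p q hp hq).1 (Summable.of_nonneg_of_le (fun K => ?_) (fun K => ?_) hρs)
  · have h := (defect_prod_brackets (Finset.range (n K)) (hp K) (hq K)).1
    have hΛ0 : 0 ≤ ∑ i ∈ Finset.range (n K), ((q K i - p K i) ^ 2 / (p K i + q K i) + (q K i - p K i) ^ 2 / (2 - p K i - q K i)) :=
      Finset.sum_nonneg fun i hi => stat₁_nonneg (hp K i hi).1 (hq K i hi).1 (hp K i hi).2 (hq K i hi).2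
    have : Real.exp (-(∑ i ∈ Finset.range (n K), ((q K i - p K i) ^ 2 / (p K i + q K i) + (q K i - p K i) ^ 2 / (2 - p K i - q K i))) / 4) ≤ Real.exp 0 :=
      Real.exp_le_exp.2 (by linarith)
    rw [Real.exp_zero] at this
    linarith
  · obtain ⟨S, hS, hle⟩ := exists_subset_one_sub_affinity_le (Finset.range (n K)).powerset
      (a := fun S => (∏ i ∈ S, p K i) * ∏ i ∈ Finset.range (n K) \ S, (1 - p K i)) (b := fun S => (∏ i ∈ S, q K i) * ∏ i ∈ Finset.range (n K) \ S, (1 - q K i))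
      (fun S hS => prodConfig_nonneg (hp K) (Finset.mem_powerset.1 hS)) (fun S hS => prodConfig_nonneg (hq K) (Finset.mem_powerset.1 hS))
      (sum_prodConfig_eq_one _ (q K))
    rw [affinity_prodConfig_eq_prod (Finset.range (n K)) (hp K) (hq K)] at hle
    have hK := hρ K 0 (by simpa using hl₀) S hS
    simp only [sum_prodConfig_eq_one, div_one] at hK
    rw [abs_sub_comm] at hK
    exact hle.trans ((le_abs_self _).trans hK)

/-- ★★ **SUFFICIENCY OF THE SQUARE-ROOT LETTER** [folklore ∕ bookkeeping]: for run-A rates in `(0, 1)` and run-B rates in `[0, 1]`, `Σ_K √Λ_K < ∞` gives SOME dials with node U5's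
`HybridNE7` on the caricature (any `vol`, `l₀ ≥ 0`) — Le Cam's `ℓ¹ ≤ 2√Λ` (§1) and FILE Q's exact ℓ¹ criterion. -/
theorem exists_hybridNE7_inhomCaricature_of_summable_sqrt_blockStat (hp : ∀ K, ∀ i ∈ Finset.range (n K), 0 < p K i ∧ p K i < 1)
    (hq : ∀ K, ∀ i ∈ Finset.range (n K), 0 ≤ q K i ∧ q K i ≤ 1) {l₀ : ℝ} (hl₀ : 0 ≤ l₀) (vol : ℝ)
    (hsum : Summable fun K => Real.sqrt (∑ i ∈ Finset.range (n K), ((q K i - p K i) ^ 2 / (p K i + q K i) + (q K i - p K i) ^ 2 / (2 - p K i - q K i)))) :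
    ∃ (Bad : ℕ → ℝ → Finset (Finset ℕ)) (W : ℕ → ℝ) (shA shB : ℕ → ℝ → Finset ℕ → ℝ) (Wsh δ : ℕ → ℝ),
      HybridNE7 l₀ vol (fun K => (Finset.range (n K)).powerset) (fun K _ S => (∏ i ∈ S, p K i) * ∏ i ∈ Finset.range (n K) \ S, (1 - p K i))
        (fun K _ S => (∏ i ∈ S, q K i) * ∏ i ∈ Finset.range (n K) \ S, (1 - q K i)) Bad W shA shB Wsh δ := by
  have hp' : ∀ K, ∀ i ∈ Finset.range (n K), 0 ≤ p K i ∧ p K i ≤ 1 := fun K i hi => ⟨(hp K i hi).1.le, (hp K i hi).2.le⟩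
  refine (exists_hybridNE7_inhomCaricature_iff_summable_l1 n p q hp hq hl₀ vol).2
    (Summable.of_nonneg_of_le (fun K => Finset.sum_nonneg fun S _ => abs_nonneg _) (fun K => ?_) (hsum.mul_left 2))
  exact l1_prodConfig_le_two_mul_sqrt_blockStat (Finset.range (n K)) (hp' K) (hq K)

/-- THE TWO LETTERS BRACKET THE ℓ¹ LETTER OF FILE Q (one step, rates in `[0, 1]`): `2·(1 − e^{−Λ_U∕4}) ≤ Σ_S |w_q − w_p| ≤ 2·√Λ_U` — Le Cam's `H² ≤ TV ≤ √2·H` on the product. [folklore] -/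
theorem l1_prodConfig_brackets {ι : Type*} [DecidableEq ι] (U : Finset ι) {p q : ι → ℝ} (hp : ∀ i ∈ U, 0 ≤ p i ∧ p i ≤ 1) (hq : ∀ i ∈ U, 0 ≤ q i ∧ q i ≤ 1) :
    2 * (1 - Real.exp (-(∑ i ∈ U, ((q i - p i) ^ 2 / (p i + q i) + (q i - p i) ^ 2 / (2 - p i - q i))) / 4)) ≤
        ∑ S ∈ U.powerset, |(∏ i ∈ S, q i) * ∏ i ∈ U \ S, (1 - q i) - (∏ i ∈ S, p i) * ∏ i ∈ U \ S, (1 - p i)| ∧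
      ∑ S ∈ U.powerset, |(∏ i ∈ S, q i) * ∏ i ∈ U \ S, (1 - q i) - (∏ i ∈ S, p i) * ∏ i ∈ U \ S, (1 - p i)| ≤
        2 * Real.sqrt (∑ i ∈ U, ((q i - p i) ^ 2 / (p i + q i) + (q i - p i) ^ 2 / (2 - p i - q i))) := by
  refine ⟨?_, l1_prodConfig_le_two_mul_sqrt_blockStat U hp hq⟩
  obtain ⟨S, hS, hle⟩ := exists_subset_one_sub_affinity_le U.powerset (a := fun S => (∏ i ∈ S, p i) * ∏ i ∈ U \ S, (1 - p i))
    (b := fun S => (∏ i ∈ S, q i) * ∏ i ∈ U \ S, (1 - q i)) (fun S hS => prodConfig_nonneg hp (Finset.mem_powerset.1 hS))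
    (fun S hS => prodConfig_nonneg hq (Finset.mem_powerset.1 hS)) (sum_prodConfig_eq_one U q)
  rw [affinity_prodConfig_eq_prod U hp hq] at hle
  have hhalf := abs_sub_le_half_sum_abs U.powerset (a := fun S => (∏ i ∈ S, p i) * ∏ i ∈ U \ S, (1 - p i))
    (b := fun S => (∏ i ∈ S, q i) * ∏ i ∈ U \ S, (1 - q i)) (by rw [sum_prodConfig_eq_one, sum_prodConfig_eq_one]) hS
  linarith [(defect_prod_brackets U hp hq).1, le_abs_self (∑ i ∈ S, (∏ j ∈ i, q j) * ∏ j ∈ U \ i, (1 - q j) - ∑ i ∈ S, (∏ j ∈ i, p j) * ∏ j ∈ U \ i, (1 - p j))]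

/-- EXCHANGEABLE BLOCKS RECOVER FILE D's STATISTIC: constant rates give `Λ_U = n·Λ₁(p, q)`. [bookkeeping] -/
theorem blockStat_const (p q : ℝ) (n : ℕ) :
    ∑ _i ∈ Finset.range n, ((q - p) ^ 2 / (p + q) + (q - p) ^ 2 / (2 - p - q)) = n * ((q - p) ^ 2 / (p + q) + (q - p) ^ 2 / (2 - p - q)) := by
  rw [Finset.sum_const, Finset.card_range, nsmul_eq_mul]

end AlongK

end Summit.QuantumFields.YangMills.BalabanUVNodes.N20InhomogeneousBlockCaricatureHellinger

end
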